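import Literature.AlgebraicTopology.SingularHomology.RelativeCochains
import Literature.AlgebraicTopology.SingularHomology.RelativeKronecker
import Literature.AlgebraicTopology.SingularHomology.RelativeCochainsKronecker
import Literature.AlgebraicTopology.SingularHomology.LocallyFlatCriticalDegree
import Literature.AlgebraicTopology.SingularHomology.LocallyFlatCriticalDegreeCharts
import Literature.AlgebraicTopology.SingularHomology.LocallyFlatComplement
import Literature.AlgebraicTopology.SingularHomology.LocalisationInjective
import Literature.AlgebraicTopology.SingularHomology.LocallyFlatPairMapLine
import Literature.AlgebraicTopology.SingularHomology.BoundaryTransfer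
import Mathlib.LinearAlgebra.FreeModule.PID
import HarnessLib

/-!
# Torsion-freeness of `H³(W, W ∖ S; ℤ)` at a straightened closed subset of Thom degree `2`
# (line `finite-level-bootstrap`, crux `GenericDivisibilityBounded`, stmt-HodgeConjecture-18467)

Pure topology. `W` second countable Hausdorff, `S = ⋃ᵢ Sᵢ` a finite disjoint union of closed
preconnected pieces straightened by charts `e : W ⇀ F × K` (`z ∈ S ↔ (e z).1 = 0` on `e.source`,
`dim_ℝ F ≥ 2`). By the tree's engines `H₂(W | Sᵢ; ℤ)` is cyclic
(`exists_forall_mem_span_localHomologyOfSet_of_locallyFlat`), `H₁(W | Sᵢ; ℤ) = 0`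
(`surjective_injective_map_compl_of_locallyFlat`), `H₂(W | S; ℤ) ↪ Πᵢ H₂(W | Sᵢ; ℤ)`
(`localHomologyOfSet.eq_zero_of_forall_restrictLocal_eq_zero`), and the relative Kronecker map
`H³(W, W ∖ S; ℤ) → Hom(H₃, ℤ)` is one-to-one once `H₂` is projective (`relKronecker_injective_succ`).
Hence `H³(W, W ∖ S; ℤ)` is torsion-free AS SOON AS every `H₂(W | Sᵢ; ℤ)` is torsion-free
(`thomH3TorsionFree_of_torsionFree`) — an ORIENTATION hypothesis on the normal structure of the
pieces, supplied by a normal coordinate = local equation of the piece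
(`thomH3TorsionFree_of_normalCoordinate`, the form matching `HodgeTheory.exists_normalCoordinate_of_chart`;
the registered stub `stub_thomH3TorsionFreeNC` of the line is this theorem verbatim). Without such a hypothesis the
statement FAILS: for the core circle `S` of `W = (open Möbius band) × ℝ`, `W ≃ S¹` and
`W ∖ S ≃` Klein bottle, so `H³(W, W ∖ S; ℤ) ≅ H²(Klein bottle; ℤ) = ℤ/2` (`H₂(W | S; ℤ) = ℤ/2`);
likewise `H³(ℂ², ℂ² ∖ ℝP²; ℤ) = ℤ/2` for a smoothly embedded real projective plane.

References: [HatcherAT2002] §3.1 Thm. 3.2, §3.3 Lemma 3.27; [VoisinHodgeI2002] §11.1.2 Lemma 11.13.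
-/

set_option linter.dupNamespace false

noncomputable section

open CategoryTheory Set TopologicalSpace Metric
open Literature.AlgebraicTopology.SingularHomology

namespace Summit.HodgeConjecture.HodgeConjecture.Theorems

/-! ### Kronecker duality: `H₂` projective ⇒ `H³` torsion-free -/

/-- **`H³(X, A; ℤ)` is torsion-free whenever the (concrete) `H₂(X, A; ℤ)` is projective**: the
relative Kronecker map `H³(X, A; ℤ) → Hom(H₃(X, A), ℤ)` is one-to-one (Hatcher Thm. 3.2, the
`Ext(H₂, ℤ)`-free case, the tree's `relKronecker_injective_succ`) and its target is torsion-free. -/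
theorem relSingularCohomology_three_eq_zero_of_nsmul_eq_zero {X : Type} [TopologicalSpace X]
    (A : Set X) (hproj : Module.Projective ℤ ((chainsInSub ℤ ℤ X A).quotient.homology 2))
    (c : relSingularCohomology ℤ ℤ X A 3) (k : ℕ) (hk : 1 ≤ k) (hkc : k • c = 0) : c = 0 := by
  have hinj := relKronecker_injective_succ ℤ A 2 hproj
  apply hinj
  rw [map_zero]
  have h : k • relKronecker ℤ X A 3 c = 0 := by rw [← map_nsmul, hkc, map_zero]
  refine LinearMap.ext fun x ↦ ?_
  have hx := LinearMap.congr_fun h x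
  rw [LinearMap.smul_apply, LinearMap.zero_apply, smul_eq_zero] at hx
  rcases hx with hx | hx
  · omega
  · rw [hx, LinearMap.zero_apply]

/-! ### Charts straightening one piece of a disjoint union -/

/-- **A chart straightening the disjoint union `⋃ Sⱼ` straightens each piece `Sᵢ`** after
restriction to the open set off the other (closed) pieces (`OpenPartialHomeomorph.restrOpen`):
on `e.source ∩ (⋃_{j ≠ i} Sⱼ)ᶜ`, `z ∈ Sᵢ ↔ z ∈ ⋃ Sⱼ ↔ (e z).1 = 0`. -/
theorem flat_piece_of_flat_iUnion {W : Type} [TopologicalSpace W] {m : ℕ} (S : Fin m → Set W)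
    (hS : ∀ i, IsClosed (S i)) (hdisj : ∀ i j, i ≠ j → Disjoint (S i) (S j))
    (hflat : ∀ x ∈ ⋃ i, S i, ∃ (F : Type) (_ : NormedAddCommGroup F) (_ : NormedSpace ℝ F)
        (_ : FiniteDimensional ℝ F) (K : Type) (_ : NormedAddCommGroup K) (_ : NormedSpace ℝ K)
        (e : OpenPartialHomeomorph W (F × K)),
        2 ≤ Module.finrank ℝ F ∧ x ∈ e.source ∧ ∀ z ∈ e.source, z ∈ (⋃ i, S i) ↔ (e z).1 = 0)
    (i : Fin m) :
    ∀ x ∈ S i, ∃ (F : Type) (_ : NormedAddCommGroup F) (_ : NormedSpace ℝ F)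
        (_ : FiniteDimensional ℝ F) (K : Type) (_ : NormedAddCommGroup K) (_ : NormedSpace ℝ K)
        (e : OpenPartialHomeomorph W (F × K)),
        2 ≤ Module.finrank ℝ F ∧ x ∈ e.source ∧ ∀ z ∈ e.source, z ∈ S i ↔ (e z).1 = 0 := by
  classical
  intro x hx
  obtain ⟨F, i₁, i₂, i₃, K, i₄, i₅, e, hF, hxe, heS⟩ := hflat x (mem_iUnion.2 ⟨i, hx⟩)
  -- the closed union `C` of the other pieces; restrict `e` to `Cᶜ`
  set C : Set W := ⋃ j ∈ Finset.univ.filter (fun j ↦ j ≠ i), S j with hCdef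
  have hC : IsClosed C := isClosed_biUnion_finset fun j _ ↦ hS j
  have hmemC : ∀ z, z ∈ C ↔ ∃ j, j ≠ i ∧ z ∈ S j := fun z ↦ by
    simp only [hCdef, mem_iUnion, Finset.mem_filter, Finset.mem_univ, true_and, exists_prop]
  refine ⟨F, i₁, i₂, i₃, K, i₄, i₅, e.restrOpen Cᶜ hC.isOpen_compl, hF, ?_, fun z hz ↦ ?_⟩
  · rw [OpenPartialHomeomorph.restrOpen_source]
    exact ⟨hxe, fun h ↦ by
      obtain ⟨j, hji, hxj⟩ := (hmemC x).1 h
      exact Set.disjoint_left.1 (hdisj j i hji) hxj hx⟩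
  · rw [OpenPartialHomeomorph.restrOpen_source] at hz
    change z ∈ S i ↔ (e z).1 = 0
    rw [← heS z hz.1, mem_iUnion]
    refine ⟨fun h ↦ ⟨i, h⟩, fun ⟨j, hzj⟩ ↦ ?_⟩
    by_contra hzi
    exact hz.2 ((hmemC z).2 ⟨j, fun hji ↦ hzi (hji ▸ hzj), hzj⟩)

/-! ### The corrected stub: torsion-free pieces ⇒ torsion-free `H³` -/

/-- **Torsion-freeness of `H³(W, W ∖ S; ℤ)` in the Thom degree `2`, from the torsion-freeness of
the pieces** `H₂(W | Sᵢ; ℤ)` (the orientation hypothesis; it fails for the core circle of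
`Möbius × ℝ`): `H₂(W | S; ℤ) ↪ Πᵢ H₂(W | Sᵢ; ℤ)` (disjoint closed pieces, Mayer–Vietoris) is finitely
generated (each factor is cyclic) and torsion-free, hence free, so the relative Kronecker map in
degree `3` is one-to-one into the torsion-free `Hom(H₃, ℤ)` (Hatcher Thm. 3.2). -/
theorem thomH3TorsionFree_of_torsionFree : ∀ {W : Type} [TopologicalSpace W]
    [SecondCountableTopology W] [T2Space W] {m : ℕ} (S : Fin m → Set W),
    (∀ i, IsClosed (S i)) → (∀ i, IsPreconnected (S i)) →
    (∀ i j, i ≠ j → Disjoint (S i) (S j)) →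
    (∀ x ∈ ⋃ i, S i, ∃ (F : Type) (_ : NormedAddCommGroup F) (_ : NormedSpace ℝ F)
        (_ : FiniteDimensional ℝ F) (K : Type) (_ : NormedAddCommGroup K) (_ : NormedSpace ℝ K)
        (e : OpenPartialHomeomorph W (F × K)),
        2 ≤ Module.finrank ℝ F ∧ x ∈ e.source ∧ ∀ z ∈ e.source, z ∈ (⋃ i, S i) ↔ (e z).1 = 0) →
    (∀ i (x : relativeSingularHomology ℤ ℤ W (S i)ᶜ 2) (n : ℕ), 1 ≤ n → n • x = 0 → x = 0) →
    ∀ (c : relSingularCohomology ℤ ℤ W (⋃ i, S i)ᶜ 3) (k : ℕ), 1 ≤ k → k • c = 0 → c = 0 := by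
  intro W _ _ _ m S hS hSc hdisj hflat htf c k hk hkc
  -- each piece is finitely generated (cyclic on its topological Thom class), hence Noetherian
  have hnoeth : ∀ i, IsNoetherian ℤ (localHomologyOfSet ℤ ℤ W (S i) 2) := fun i ↦ by
    obtain ⟨θ, hθ⟩ := exists_forall_mem_span_localHomologyOfSet_of_locallyFlat ℤ (hS i) (hSc i)
      (le_refl 2) (flat_piece_of_flat_iUnion S hS hdisj hflat i)
    haveI : Module.Finite ℤ (localHomologyOfSet ℤ ℤ W (S i) 2) :=
      Module.Finite.of_surjective (LinearMap.toSpanSingleton ℤ _ θ) fun x ↦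
        Submodule.mem_span_singleton.1 (hθ x)
    infer_instance
  -- a class of `H₂(W | S)` vanishing at every piece vanishes (disjoint closed pieces, Mayer–Vietoris)
  have hdet : ∀ x : localHomologyOfSet ℤ ℤ W (⋃ i, S i) 2,
      (∀ i, restrictLocal ℤ ℤ (subset_iUnion S i) 2 x = 0) → x = 0 := fun x hx ↦
    localHomologyOfSet.eq_zero_of_forall_restrictLocal_eq_zero ℤ ℤ S hS Finset.univ
      (fun i _ j _ hij ↦ hdisj i j hij) (⋃ i, S i) (by simp) 2 x fun i _ ↦ hx i
  -- so `H₂(W | S) ↪ Πᵢ H₂(W | Sᵢ)` is finitely generated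
  let Φ := LinearMap.pi (R := ℤ) fun i ↦ (restrictLocal ℤ ℤ (subset_iUnion S i) 2).hom
  have hΦ : Function.Injective Φ :=
    (injective_iff_map_eq_zero Φ).2 fun x hx ↦ hdet x fun i ↦ congr_fun hx i
  have hNpi := @isNoetherian_pi ℤ _ (Fin m) _ (fun i ↦ ↥(localHomologyOfSet ℤ ℤ W (S i) 2)) _ _ hnoeth
  haveI : Module.Finite ℤ (localHomologyOfSet ℤ ℤ W (⋃ i, S i) 2) :=
    @Module.Finite.of_injective ℤ ℤ _ _ _ _ _ _ _ (Pi.module _ _ _) hNpi _ _ _ _ Φ hΦ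
  -- and torsion-free
  haveI : Module.IsTorsionFree ℤ (localHomologyOfSet ℤ ℤ W (⋃ i, S i) 2) := by
    refine Module.IsTorsionFree.of_smul_eq_zero fun r x hrx ↦ ?_
    by_cases hr : r = 0
    · exact Or.inl hr
    · right
      have hn : r.natAbs • x = 0 := by
        rcases Int.natAbs_eq r with h | h
        · rw [← Nat.cast_smul_eq_nsmul ℤ, ← h, hrx]
        · have h' : (r.natAbs : ℤ) = -r := by omega
          rw [← Nat.cast_smul_eq_nsmul ℤ, h', neg_smul, hrx, neg_zero]
      refine hdet x fun i ↦ htf i _ r.natAbs (Int.natAbs_pos.2 hr) ?_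
      rw [← map_nsmul, hn, map_zero]
  -- hence free and projective, in both models of `H₂(W, W ∖ S; ℤ)`
  haveI : Module.Free ℤ (localHomologyOfSet ℤ ℤ W (⋃ i, S i) 2) :=
    Module.free_of_finite_type_torsion_free'
  haveI : Module.Projective ℤ (localHomologyOfSet ℤ ℤ W (⋃ i, S i) 2) := Module.Projective.of_free
  have hproj : Module.Projective ℤ ((chainsInSub ℤ ℤ W (⋃ i, S i)ᶜ).quotient.homology 2) :=
    Module.Projective.of_equiv (relativeSingularHomology.concreteIso ℤ ℤ W (⋃ i, S i)ᶜ 2).toLinearEquiv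
  exact relSingularCohomology_three_eq_zero_of_nsmul_eq_zero _ hproj c k hk hkc

/-! ### The orientation hypothesis in geometric form: a normal coordinate (local equation) -/

/-- **A cyclic `ℤ`-module with an element of infinite order is torsion-free** (if `M = ℤ θ`,
`y = a θ` has infinite order and `n (b θ) = 0`, `n ≥ 1`, `b ≠ 0`, then `|n b| y = 0`); stated for an
arbitrary `ℤ`-module structure (the bundled one of the homology groups) and `ℕ`-multiples. -/
theorem torsionFree_of_cyclic_of_infiniteOrder {M : Type*} [AddCommGroup M] [Module ℤ M] {θ y : M}
    (hθ : ∀ x, x ∈ Submodule.span ℤ ({θ} : Set M)) (hy : ∀ n : ℕ, 1 ≤ n → n • y ≠ 0) :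
    ∀ (x : M) (n : ℕ), 1 ≤ n → n • x = 0 → x = 0 := by
  set f := LinearMap.toSpanSingleton ℤ M θ with hf
  have hfx : ∀ x, ∃ b : ℤ, f b = x := fun x ↦ by
    obtain ⟨b, hb⟩ := Submodule.mem_span_singleton.1 (hθ x)
    exact ⟨b, hb⟩
  intro x n hn hnx
  obtain ⟨b, rfl⟩ := hfx x
  obtain ⟨a, ha⟩ := hfx y
  by_cases hb : b = 0
  · rw [hb, map_zero]
  -- `f (n b) = 0`, so `f |n b| = 0` and `f (c |n b|) = 0` for every `c`
  have h1 : f ((n : ℤ) * b) = 0 := by rw [← nsmul_eq_mul, map_nsmul, hnx]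
  set k : ℤ := (n : ℤ) * b with hk
  have hk0 : k ≠ 0 := mul_ne_zero (by exact_mod_cast (by omega : n ≠ 0)) hb
  have hK : f (k.natAbs : ℤ) = 0 := by
    rcases Int.natAbs_eq k with h | h
    · rw [← h, h1]
    · have h' : (k.natAbs : ℤ) = -k := by omega
      rw [h', map_neg, h1, neg_zero]
  have hmul : ∀ c : ℤ, f (c * (k.natAbs : ℤ)) = 0 := by
    intro c
    rcases Int.natAbs_eq c with h | h
    · rw [h, ← nsmul_eq_mul, map_nsmul, hK, nsmul_zero]
    · rw [h, neg_mul, ← nsmul_eq_mul, map_neg, map_nsmul, hK, nsmul_zero, neg_zero]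
  -- hence `|n b| y = f (a |n b|) = 0`, contradicting the infinite order of `y`
  have hy0 : k.natAbs • y = 0 := by
    rw [← ha, ← map_nsmul, nsmul_eq_mul, mul_comm]
    exact hmul a
  exact absurd hy0 (hy k.natAbs (Int.natAbs_pos.2 hk0))

/-- **`H₂(W | T; ℤ)` is torsion-free when `T` carries a normal coordinate** (a local equation; the
topological content of the Lelong–Poincaré formula, Voisin I §11.1.2 / proof of Thm. 11.33): `N ⊇ T`
open, `Φ : W → ℂ` continuous on `N` and non-zero on `N ∖ T`, reading `Φ = c · (e₀ ·).1` (`c`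
continuous, nowhere zero) in ONE straightening chart `e₀ : W ⇀ ℂ × K₀` at a point `s₀ ∈ T`. A small
box of `e₀` at `s₀` carries a class with non-zero image under `Φ_*` in `H₂(ℂ | 0; ℤ) ≅ ℤ`
(`exists_map_box_ne_zero`), hence of infinite order in the cyclic `H₂(N | T; ℤ)`, which is thus
torsion-free; conclude by excision `H₂(N | T) ≅ H₂(W | T)` (`localHomologyOfSet.openSubsetIso`). -/
theorem torsionFree_localHomologyOfSet_two_of_normalCoordinate {W : Type} [TopologicalSpace W]
    [SecondCountableTopology W] {T : Set W} (hT : IsClosed T) (hTc : IsPreconnected T)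
    (hflat : ∀ x ∈ T, ∃ (F : Type) (_ : NormedAddCommGroup F) (_ : NormedSpace ℝ F)
        (_ : FiniteDimensional ℝ F) (K : Type) (_ : NormedAddCommGroup K) (_ : NormedSpace ℝ K)
        (e : OpenPartialHomeomorph W (F × K)),
        2 ≤ Module.finrank ℝ F ∧ x ∈ e.source ∧ ∀ z ∈ e.source, z ∈ T ↔ (e z).1 = 0)
    {N : Set W} (hN : IsOpen N) (hTN : T ⊆ N) {Φ : W → ℂ} (hΦc : ContinuousOn Φ N)
    (hΦ0 : ∀ z ∈ N, Φ z = 0 → z ∈ T)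
    {K₀ : Type} [NormedAddCommGroup K₀] [NormedSpace ℝ K₀] (e₀ : OpenPartialHomeomorph W (ℂ × K₀))
    (he₀T : ∀ z ∈ e₀.source, z ∈ T ↔ (e₀ z).1 = 0) {s₀ : W} (hs₀ : s₀ ∈ e₀.source) (hs₀T : s₀ ∈ T)
    {c : W → ℂ} (hc : ContinuousOn c e₀.source) (hc0 : ∀ z ∈ e₀.source, c z ≠ 0)
    (hΦe : ∀ z ∈ e₀.source, Φ z = c z * (e₀ z).1) :
    ∀ (x : relativeSingularHomology ℤ ℤ W Tᶜ 2) (n : ℕ), 1 ≤ n → n • x = 0 → x = 0 := by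
  -- the open subspace `Y = ↥N` with its closed, preconnected, straightened subset `T' = T`
  have hne : Nonempty (⟨N, hN⟩ : Opens W) := ⟨⟨s₀, hTN hs₀T⟩⟩
  set T' : Set ↥N := Subtype.val ⁻¹' T with hT'def
  have hT' : IsClosed T' := hT.preimage continuous_subtype_val
  have hT'c : IsPreconnected T' := by
    refine (Topology.IsInducing.subtypeVal.isPreconnected_image).1 ?_
    have himg : Subtype.val '' T' = T := by
      rw [hT'def, Subtype.image_preimage_coe, inter_eq_right.2 hTN]
    rw [himg]
    exact hTc
  have hflat' : ∀ x ∈ T', ∃ (F : Type) (_ : NormedAddCommGroup F) (_ : NormedSpace ℝ F)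
      (_ : FiniteDimensional ℝ F) (K : Type) (_ : NormedAddCommGroup K) (_ : NormedSpace ℝ K)
      (e : OpenPartialHomeomorph ↥N (F × K)),
      2 ≤ Module.finrank ℝ F ∧ x ∈ e.source ∧ ∀ z ∈ e.source, z ∈ T' ↔ (e z).1 = 0 := by
    intro x hx
    obtain ⟨F, i₁, i₂, i₃, K, i₄, i₅, e, hkF, hxe, heS⟩ := hflat x.1 hx
    let e' : OpenPartialHomeomorph ↥N (F × K) := e.subtypeRestr (s := ⟨N, hN⟩) hne
    have he's : e'.source = Subtype.val ⁻¹' e.source := e.subtypeRestr_source hne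
    refine ⟨F, i₁, i₂, i₃, K, i₄, i₅, e', hkF, ?_, fun z hz ↦ ?_⟩
    · rw [he's]
      exact hxe
    · rw [he's] at hz
      exact heS z.1 hz
  -- the map of pairs `Φ' : (Y, Y ∖ T') → (ℂ, ℂ ∖ 0)`, straight in the chart `e₀` restricted to `Y`
  let Φ' : C(↥N, ℂ) := ⟨N.restrict Φ, hΦc.restrict⟩
  have hΦ' : MapsTo Φ' T'ᶜ ({0}ᶜ : Set ℂ) := fun z hz h0 ↦ hz (hΦ0 z.1 z.2 h0)
  let e₀' : OpenPartialHomeomorph ↥N (ℂ × K₀) := e₀.subtypeRestr (s := ⟨N, hN⟩) hne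
  have he₀'s : e₀'.source = Subtype.val ⁻¹' e₀.source := e₀.subtypeRestr_source hne
  have he₀'T : ∀ z ∈ e₀'.source, z ∈ T' ↔ (e₀' z).1 = 0 := fun z hz ↦ by
    rw [he₀'s] at hz
    exact he₀T z.1 hz
  set s₀' : ↥N := ⟨s₀, hTN hs₀T⟩ with hs₀'def
  have hs₀' : s₀' ∈ e₀'.source := by
    rw [he₀'s]
    exact hs₀
  have hc' : ContinuousOn (fun z : ↥N ↦ c z.1) e₀'.source := by
    rw [he₀'s]
    exact hc.comp continuous_subtype_val.continuousOn fun z hz ↦ hz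
  have hc0' : ∀ z ∈ e₀'.source, c z.1 ≠ 0 := fun z hz ↦ hc0 z.1 (by rwa [he₀'s] at hz)
  have hΦe' : ∀ z ∈ e₀'.source, Φ' z = id (c z.1 * (e₀' z).1) := fun z hz ↦ by
    rw [he₀'s] at hz
    exact hΦe z.1 hz
  -- a box of `e₀'` at `s₀` carries a class `x` with `Φ'_* x ≠ 0` in `H₂(ℂ | 0; ℤ)`
  obtain ⟨r, hr0, -, hBt, -, -⟩ :=
    exists_box_subset e₀' he₀'T (show s₀' ∈ T' from hs₀T) hs₀' isOpen_univ (mem_univ _) zero_lt_one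
  have hΦB : MapsTo (Φ'.comp (subsetIncl (e₀'.source ∩ e₀' ⁻¹' ball ((0 : ℂ), (e₀' s₀').2) r)))
      (Subtype.val ⁻¹' T' : Set ↥(e₀'.source ∩ e₀' ⁻¹' ball ((0 : ℂ), (e₀' s₀').2) r))ᶜ
      ({0}ᶜ : Set ℂ) := fun z hz ↦ hΦ' hz
  obtain ⟨x, hx⟩ := exists_map_box_ne_zero ℤ e₀' he₀'T (e₀' s₀').2 hr0 hBt Φ' (p₀ := 0) (j := id)
    Topology.IsOpenEmbedding.id rfl hc' hc0' hΦe' hΦB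
  -- its image `d₀ ∈ H₂(Y | T'; ℤ)` has infinite order, `H₂(ℂ | 0; ℤ) ≅ ℤ` being torsion-free
  set d₀ := localHomologyOfSet.toAmbient ℤ ℤ T' _ 2 x with hd₀
  have hd₀Φ : relativeSingularHomology.map ℤ ℤ Φ' hΦ' 2 d₀ =
      relativeSingularHomology.map ℤ ℤ (Φ'.comp (subsetIncl _)) hΦB 2 x := by
    rw [hd₀, localHomologyOfSet.toAmbient, ← ModuleCat.comp_apply, ← relativeSingularHomology.map_comp]
  obtain ⟨ι⟩ := nonempty_localHomology_complex_zero_iso ℤ ℤ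
  have hd₀inf : ∀ n : ℕ, 1 ≤ n → n • d₀ ≠ 0 := by
    intro n hn h0
    apply hx
    rw [← hd₀Φ]
    have h1 : n • relativeSingularHomology.map ℤ ℤ Φ' hΦ' 2 d₀ = 0 := by
      rw [← map_nsmul, h0, map_zero]
    apply ι.toLinearEquiv.injective
    rw [map_zero]
    have h2 : (n : ℤ) * ι.toLinearEquiv (relativeSingularHomology.map ℤ ℤ Φ' hΦ' 2 d₀) = 0 := by
      rw [← nsmul_eq_mul, ← map_nsmul, h1, map_zero]
    exact (mul_eq_zero.1 h2).resolve_left (by exact_mod_cast (by omega : n ≠ 0))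
  -- `H₂(Y | T'; ℤ)` is cyclic, hence torsion-free
  obtain ⟨θ, hθ⟩ :=
    exists_forall_mem_span_localHomologyOfSet_of_locallyFlat ℤ hT' hT'c (le_refl 2) hflat'
  have htf' := torsionFree_of_cyclic_of_infiniteOrder hθ hd₀inf
  -- transport along the excision isomorphism `H₂(Y | T') ≅ H₂(W | T)`
  let E := localHomologyOfSet.openSubsetIso ℤ ℤ hN (by rwa [hT.closure_eq]) 2
  intro y n hn hny
  change n • (y : localHomologyOfSet ℤ ℤ W T 2) = 0 at hny
  have h4 : E.inv y = 0 := htf' (E.inv y) n hn (by rw [← map_nsmul, hny, map_zero])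
  rw [← show E.hom (E.inv y) = y from Iso.inv_hom_id_apply E y, h4, map_zero]

/-- **Torsion-freeness of `H³(W, W ∖ S; ℤ)` in the Thom degree `2`, geometric orientation
hypothesis**: each piece `Sᵢ` has a normal coordinate (an open `N ⊇ Sᵢ`, `Φ : W → ℂ` continuous on
`N`, non-zero on `N ∖ Sᵢ`, reading `Φ = c · (e₀ ·).1` with `c` continuous nowhere zero in one
straightening chart `e₀ : W ⇀ ℂ × K₀` at a point of `Sᵢ` — in the application a local equation of
the curve, cf. `HodgeTheory.exists_normalCoordinate_of_chart`). -/
theorem thomH3TorsionFree_of_normalCoordinate : ∀ {W : Type} [TopologicalSpace W]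
    [SecondCountableTopology W] [T2Space W] {m : ℕ} (S : Fin m → Set W),
    (∀ i, IsClosed (S i)) → (∀ i, IsPreconnected (S i)) →
    (∀ i j, i ≠ j → Disjoint (S i) (S j)) →
    (∀ x ∈ ⋃ i, S i, ∃ (F : Type) (_ : NormedAddCommGroup F) (_ : NormedSpace ℝ F)
        (_ : FiniteDimensional ℝ F) (K : Type) (_ : NormedAddCommGroup K) (_ : NormedSpace ℝ K)
        (e : OpenPartialHomeomorph W (F × K)),
        2 ≤ Module.finrank ℝ F ∧ x ∈ e.source ∧ ∀ z ∈ e.source, z ∈ (⋃ i, S i) ↔ (e z).1 = 0) →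
    (∀ i, ∃ (N : Set W) (Φ c : W → ℂ) (K₀ : Type) (_ : NormedAddCommGroup K₀) (_ : NormedSpace ℝ K₀)
        (e₀ : OpenPartialHomeomorph W (ℂ × K₀)) (s₀ : W),
        IsOpen N ∧ S i ⊆ N ∧ ContinuousOn Φ N ∧ (∀ z ∈ N, Φ z = 0 → z ∈ S i) ∧
        (∀ z ∈ e₀.source, z ∈ S i ↔ (e₀ z).1 = 0) ∧ s₀ ∈ e₀.source ∧ s₀ ∈ S i ∧
        ContinuousOn c e₀.source ∧ (∀ z ∈ e₀.source, c z ≠ 0) ∧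
        ∀ z ∈ e₀.source, Φ z = c z * (e₀ z).1) →
    ∀ (c : relSingularCohomology ℤ ℤ W (⋃ i, S i)ᶜ 3) (k : ℕ), 1 ≤ k → k • c = 0 → c = 0 := by
  intro W _ _ _ m S hS hSc hdisj hflat hnc
  refine thomH3TorsionFree_of_torsionFree S hS hSc hdisj hflat fun i ↦ ?_
  obtain ⟨N, Φ, c, K₀, _, _, e₀, s₀, hN, hSN, hΦc, hΦ0, he₀S, hs₀, hs₀S, hc, hc0, hΦe⟩ := hnc i
  exact torsionFree_localHomologyOfSet_two_of_normalCoordinate (hS i) (hSc i)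
    (flat_piece_of_flat_iUnion S hS hdisj hflat i) hN hSN hΦc hΦ0 e₀ he₀S hs₀ hs₀S hc hc0 hΦe

/-! ### The registered stub of the line `finite-level-bootstrap` -/

/-- **Registered stub `stub_thomH3TorsionFreeNC`** (crux `GenericDivisibilityBounded`,
stmt-HodgeConjecture-18467, line `finite-level-bootstrap`): torsion-freeness of `H³(W, W ∖ S; ℤ)` in
the Thom degree `2` for a finite disjoint union of closed preconnected straightened pieces, each
carrying a normal coordinate — verbatim `thomH3TorsionFree_of_normalCoordinate`. -/
theorem stub_thomH3TorsionFreeNC :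
    ∀ {W : Type} [TopologicalSpace W] [SecondCountableTopology W] [T2Space W]
      {m : ℕ} (S : Fin m → Set W),
      (∀ i, IsClosed (S i)) → (∀ i, IsPreconnected (S i)) →
      (∀ i j, i ≠ j → Disjoint (S i) (S j)) →
      (∀ x ∈ ⋃ i, S i, ∃ (F : Type) (_ : NormedAddCommGroup F) (_ : NormedSpace ℝ F)
          (_ : FiniteDimensional ℝ F) (K : Type) (_ : NormedAddCommGroup K) (_ : NormedSpace ℝ K)
          (e : OpenPartialHomeomorph W (F × K)),
          2 ≤ Module.finrank ℝ F ∧ x ∈ e.source ∧ ∀ z ∈ e.source, z ∈ (⋃ i, S i) ↔ (e z).1 = 0) →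
      (∀ i, ∃ (N : Set W) (Φ c : W → ℂ) (K₀ : Type) (_ : NormedAddCommGroup K₀) (_ : NormedSpace ℝ K₀)
          (e₀ : OpenPartialHomeomorph W (ℂ × K₀)) (s₀ : W),
          IsOpen N ∧ S i ⊆ N ∧ ContinuousOn Φ N ∧ (∀ z ∈ N, Φ z = 0 → z ∈ S i) ∧
          (∀ z ∈ e₀.source, z ∈ S i ↔ (e₀ z).1 = 0) ∧ s₀ ∈ e₀.source ∧ s₀ ∈ S i ∧
          ContinuousOn c e₀.source ∧ (∀ z ∈ e₀.source, c z ≠ 0) ∧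
          ∀ z ∈ e₀.source, Φ z = c z * (e₀ z).1) →
      ∀ (c : relSingularCohomology ℤ ℤ W (⋃ i, S i)ᶜ 3) (k : ℕ), 1 ≤ k → k • c = 0 → c = 0 :=
  fun S hS hSc hdisj hflat hnc ↦ thomH3TorsionFree_of_normalCoordinate S hS hSc hdisj hflat hnc

end Summit.HodgeConjecture.HodgeConjecture.Theorems

end
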